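import Literature.NumberTheory.GaloisCohomology.Howard2004.CasselsTateSkewPairingOfTowerPairingProofs
import Literature.NumberTheory.GaloisCohomology.Howard2004.DVRLevelSelmerFiniteProofs
import HarnessLib

/-!
# Howard 2004, Prop. 1.4.1 in tower currency: ONE kernel suffices — the RIGHT kernel of a two-module pairing
# `H¹_{𝓕(n)}(K, T^{(t)}) × H¹_{𝓕(n)}(K, T^{(0)}) → R/𝔪` follows from its LEFT kernel by counting (proofs file)

Topic `NumberTheory/GaloisCohomology/Howard2004`. THEOREMS ONLY: no definition, no named fact, no instance, no notation,
no `sorry`.  Cell `pub/bsd-print-x9` (seat x10b-p1-w8 g12, brick «C451-ONE-KERNEL», `--supports stmt-BirchSwinnertonDyer-22642`;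
print leaf G87 = Howard Thm. 1.6.1 ↦ (plan g15 r8) the «Flach leaf» C45.1′
`Literature.NumberTheory.GaloisCohomology.Howard2004.prop141_casselsTate_skewPairing_atLevel`).  Sequel of the tower entry
`CasselsTateSkewPairingOfTowerPairingProofs` (x10b-p1-w7 g12): there the five clauses of the typed leaf are obtained from a
two-module pairing `P₂ : 𝓗_t(n) × 𝓗_0(n) → R/𝔪` (`𝓗_j(n) = H¹_{𝓕(n)}(K, T^{(j)})` on a FULL `DVRSetting`, `T^{(j)} = T/𝔪^{j+1}T`)
carrying BOTH kernels of Prop. 1.4.1 (LEFT `= H¹(red)(𝓗_{t+1}(n))`, RIGHT `= H¹(red^{t+1})(𝓗_{t+1}(n))`) and the skew identity.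

SOURCE. B. Howard, *The Heegner point Kolyvagin system*, Compositio Math. **140** (2004) = arXiv:1202.6340, Prop. 1.4.1
(p0008 L83–98: «there is a pairing `( , )_{s,t} : H¹_𝓕(K, T/𝔪^sT) × H¹_{𝓕*}(K, T*[𝔪^t]) → R` whose kernels on the left and
right are the images of `H¹_𝓕(K, T/𝔪^{s+t}T) → H¹_𝓕(K, T/𝔪^sT)`, `H¹_{𝓕*}(K, T*[𝔪^{s+t}]) →^{π^s} H¹_{𝓕*}(K, T*[𝔪^t])`.
*Proof.* […] The computation of the kernels is a straightforward modification of the methods of [Flach]»), Lemma 1.3.3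
(p. 7 L152–160: «the map `H¹_𝓕(K, S) → H¹_𝓕(K, T)[I]` is surjective»), proof of Thm. 1.4.2 (p0008 L108–L142: the
identifications `H¹_𝓕(K, T/𝔪^sT) ≅ ℋ[𝔪^s]`, and «`dim V_s = dim W_s`» implicit in «nondegenerate pairing of `R/𝔪`-vector
spaces `V_s × W_s → R[𝔪]`»).

WHAT IS PROVED.
* §0 (pure linear algebra over a finite field `𝔽`; Mathlib only) **`card_mul_card_rightKer_le`**: for a finite additive group
  `A`, a finite `𝔽`-space `B` and ANY additive `P : A → (B →ₗ[𝔽] 𝔽)`, `#A · #{w | ∀ a, P a w = 0} ≤ #ker P · #B` (the range of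
  `P` sits in the dual annihilator of the right kernel); **`forall_apply_eq_zero_iff_mem_of_leftKer_of_card`**: hence if the
  LEFT kernel is a given subgroup `A'`, a subgroup `B'` sits inside the right kernel and `#A · #B' = #A' · #B`, then the RIGHT
  kernel IS `B'`.
* §1 (the count on a full tower, Lemma 1.3.3) **`card_selmerGroup_atLevel_succ_eq_card_zero_mul_card_map_redLEH1`** and
  **`card_selmerGroup_atLevel_succ_eq_card_mul_card_map_redLEH1_zero`**:
  `#𝓗_{t+1}(n) = #𝓗_0(n) · #H¹(red_{t+1→t})(𝓗_{t+1}(n)) = #𝓗_t(n) · #H¹(red_{t+1→0})(𝓗_{t+1}(n))` — the kernels of the two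
  reductions on `𝓗_{t+1}(n)` are `H¹(inc^{t+1})(𝓗_0(n))` and `H¹(inc)(𝓗_t(n))` (Lemma 1.3.3 at level `n` as an `iff`,
  `mem_selmerGroup_atLevel_and_pow_eq_zero_iff_exists_incH1LE`, and `H¹(inc) ∘ H¹(red) = π^d`, `incH1LE_redLEH1`), so that
  `#(𝓗_t(n) / red 𝓗_{t+1}(n)) = #(𝓗_0(n) / red^{t+1} 𝓗_{t+1}(n))` («`dim V_s = dim W_s`»).
* §2 **`towerPairing_hright_of_hleft`** — on a FULL `DVRSetting` with H.0–H.5, `k`, `n ∈ 𝓝^{(k)}`, `t + 1 < e_k`: for a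
  bi-additive `P₂ : 𝓗_t(n) × 𝓗_0(n) → R/𝔪`, `R`-equivariant in the second slot, whose LEFT kernel is `H¹(red)(𝓗_{t+1}(n))` and
  whose right kernel CONTAINS `H¹(red^{t+1})(𝓗_{t+1}(n))`, the RIGHT kernel IS `H¹(red^{t+1})(𝓗_{t+1}(n))` — the clause `hright`
  of `skewPairings_display_of_towerSkewPairing` / `hasLevelDecompositionsAt_of_towerSkewPairings` from `hleft` and the
  one-sided inclusion.
* §3 **`hasLevelDecompositionsAt_of_towerLeftKernelPairings`**, **`prop141_casselsTate_skewPairing_atLevel_of_forall_full_towerLeftKernelPairings`**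
  — the per-setting slot `HasLevelDecompositionsAt` and the by-name leaf C45.1′ from two-module pairings on FULL towers carrying
  `R`-equivariance, the LEFT kernel, the one-sided right inclusion and the skew identity (x10b-p1-w7 g12's theorems with the
  clause `hright` discharged by §2).

READING (numbers, for the desk).  The consumer chain `hasLevelDecompositionsAt_of_skewPairings` reads the RIGHT kernel and the
skew identity only.  After this file a kernel port of Prop. 1.4.1 / Flach (Morgan–Smith arXiv:2103.08530 Prop. 3.5: LEFT kernel
`= π(Sel M)`) may deliver the LEFT kernel plus the inclusion «`red^{t+1}(Sel N_{t+1})` pairs to zero» (an «image ⊆ annihilator»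
statement) INSTEAD of computing the right kernel through the duality identity `CTP_E(a,b) = CTP_{E^∨}(b,a)` and the H.4
transport: that half of brick F4 leaves the critical path.  Nothing of the pairing is constructed here.

HONEST FRAMING: the two-module pairing is a HYPOTHESIS of §2–§3; Flach's pairing is not constructed; Prop. 1.4.1, Thm. 1.4.2,
C45.1′ and `thm161_dvrKolyvaginBound` are NOT proved; no summit statement is proved; the Birch–Swinnerton-Dyer conjecture
is not proved by any of this.
-/

set_option autoImplicit false

noncomputable section

namespace Literature.NumberTheory.GaloisCohomology.Howard2004

open Function NumberField IsDedekindDomain Field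
open scoped NumberField ContRepresentation
open Literature.NumberTheory.GaloisRepresentations
open Literature.NumberTheory.GaloisRepresentations.DiscreteGaloisModule

/-! ## §0 Linear algebra: one kernel of a finite pairing determines the size of the other -/

section OneKernel

variable {𝔽 : Type*} [Field 𝔽] [Finite 𝔽] {B : Type*} [AddCommGroup B] [Module 𝔽 B] [Finite B]
  {A : Type*} [AddCommGroup A] [Finite A]

omit [Finite A] in
/-- **One kernel bounds the other.**  For an additive group `A`, a finite vector space `B` over a finite field `𝔽`
and an additive family of linear forms `P : A → (B →ₗ[𝔽] 𝔽)` (a pairing `A × B → 𝔽`, additive in `a`, linear in `b`):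
`#A · #{w | ∀ a, P a w = 0} ≤ #(ker P) · #B` — i.e. `#(A / leftker) ≤ #(B / rightker)`: the range of `P` lies in the dual
annihilator of the right kernel `W`, whose dimension is `dim B - dim W`. [folklore]
[cite: Howard2004HeegnerKolyvagin, proof of Thm. 1.4.2 (arXiv:1202.6340 p0008 L120–L126: «nondegenerate pairing of R/𝔪-vector spaces V_s × W_s»)] -/
theorem card_mul_card_rightKer_le (P : A →+ (B →ₗ[𝔽] 𝔽)) :
    Nat.card A * Nat.card ↥(⨅ a, LinearMap.ker (P a) : Submodule 𝔽 B) ≤ Nat.card ↥P.ker * Nat.card B := by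
  classical
  haveI : Module.Finite 𝔽 B := Module.Finite.of_finite
  haveI : Module.Finite 𝔽 (Module.Dual 𝔽 B) := inferInstance
  haveI : Finite (Module.Dual 𝔽 B) := Module.finite_of_finite 𝔽
  set W : Submodule 𝔽 B := ⨅ a, LinearMap.ker (P a) with hW
  -- the range of `P` sits inside the dual annihilator of `W`
  have hrange : ∀ φ : ↥P.range, (φ : Module.Dual 𝔽 B) ∈ W.dualAnnihilator := by
    rintro ⟨φ, a, rfl⟩
    rw [Submodule.mem_dualAnnihilator]
    intro w hw
    rw [hW, Submodule.mem_iInf] at hw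
    exact hw a
  have hinj : Function.Injective (fun φ : ↥P.range => (⟨(φ : Module.Dual 𝔽 B), hrange φ⟩ : ↥W.dualAnnihilator)) := by
    intro φ ψ h
    have h' := congrArg (fun z : ↥W.dualAnnihilator => (z : Module.Dual 𝔽 B)) h
    exact Subtype.ext h'
  haveI : Module.Finite 𝔽 ↥W := Module.Finite.of_finite
  haveI : Module.Finite 𝔽 ↥W.dualAnnihilator := Module.Finite.of_finite
  have h1 : Nat.card ↥P.range ≤ Nat.card ↥W.dualAnnihilator := Nat.card_le_card_of_injective _ hinj
  -- `#A = #ker P · #range P`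
  have h2 : Nat.card A = Nat.card ↥P.ker * Nat.card ↥P.range := by
    rw [mul_comm, ← Nat.card_congr (QuotientAddGroup.quotientKerEquivRange P).toEquiv]
    exact AddSubgroup.card_eq_card_quotient_mul_card_addSubgroup P.ker
  -- `#W · #W^⊥ = #B` (`dim W + dim W^⊥ = dim B`)
  have h3 : Nat.card ↥W.dualAnnihilator * Nat.card ↥W = Nat.card B := by
    rw [Module.natCard_eq_pow_finrank (K := 𝔽) (V := ↥W.dualAnnihilator),
      Module.natCard_eq_pow_finrank (K := 𝔽) (V := ↥W), Module.natCard_eq_pow_finrank (K := 𝔽) (V := B),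
      ← pow_add, add_comm, Subspace.finrank_add_finrank_dualAnnihilator_eq W]
  calc Nat.card A * Nat.card ↥W
      = Nat.card ↥P.ker * (Nat.card ↥P.range * Nat.card ↥W) := by rw [h2, mul_assoc]
    _ ≤ Nat.card ↥P.ker * (Nat.card ↥W.dualAnnihilator * Nat.card ↥W) :=
        Nat.mul_le_mul_left _ (Nat.mul_le_mul_right _ h1)
    _ = Nat.card ↥P.ker * Nat.card B := by rw [h3]

/-- **One kernel determines the other.**  In the situation of `card_mul_card_rightKer_le`, if the LEFT kernel
`{a | ∀ w, P a w = 0}` is a subgroup `A'`, a subgroup `B'` of `B` pairs to zero with everything, and the count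
`#A · #B' = #A' · #B` holds («`dim V_s = dim W_s`»), then the RIGHT kernel `{w | ∀ a, P a w = 0}` IS `B'`. [folklore]
[cite: Howard2004HeegnerKolyvagin, proof of Thm. 1.4.2 (arXiv:1202.6340 p0008 L120–L126)] -/
theorem forall_apply_eq_zero_iff_mem_of_leftKer_of_card (P : A →+ (B →ₗ[𝔽] 𝔽)) (A' : AddSubgroup A)
    (B' : AddSubgroup B) (hleft : ∀ a, (∀ w, P a w = 0) ↔ a ∈ A') (hB' : ∀ w ∈ B', ∀ a, P a w = 0)
    (hcount : Nat.card A * Nat.card ↥B' = Nat.card ↥A' * Nat.card B) :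
    ∀ w, (∀ a, P a w = 0) ↔ w ∈ B' := by
  classical
  set W : Submodule 𝔽 B := ⨅ a, LinearMap.ker (P a) with hW
  have hmemW : ∀ w, w ∈ W ↔ ∀ a, P a w = 0 := fun w => by
    rw [hW, Submodule.mem_iInf]
    exact forall_congr' fun a => LinearMap.mem_ker
  -- the left kernel of `P` is `A'`
  have hker : P.ker = A' := by
    ext a
    rw [AddMonoidHom.mem_ker, ← hleft a]
    constructor
    · intro h w
      rw [h, LinearMap.zero_apply]
    · intro h
      exact LinearMap.ext fun w => by rw [h w, LinearMap.zero_apply]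
  -- `#W ≤ #B'`
  have hle := card_mul_card_rightKer_le P
  rw [hker, ← hcount] at hle
  have hApos : 0 < Nat.card A := Nat.card_pos
  have hWle : Nat.card ↥W ≤ Nat.card ↥B' := Nat.le_of_mul_le_mul_left hle hApos
  -- `B' ⊆ W`, hence `B' = W` as sets
  have hsub : (B' : Set B) ⊆ (W : Set B) := fun w hw => (hmemW w).2 (hB' w hw)
  have hWle' : (W : Set B).ncard ≤ (B' : Set B).ncard := by
    rw [← Nat.card_coe_set_eq, ← Nat.card_coe_set_eq]
    exact hWle
  have heq : (B' : Set B) = (W : Set B) := Set.eq_of_subset_of_ncard_le hsub hWle' (Set.toFinite _)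
  intro w
  rw [← hmemW, ← SetLike.mem_coe, ← heq, SetLike.mem_coe]

end OneKernel

/-! ## §1 The count `#𝓗_{t+1}(n) = #𝓗_0(n) · #red(𝓗_{t+1}(n)) = #𝓗_t(n) · #red^{t+1}(𝓗_{t+1}(n))` on a full tower -/

section Count

/-- Cardinality bookkeeping: for an additive map `f` and a finite subgroup `H`, `#H = #f(H) · #{x ∈ H | f x = 0}`.
[folklore] -/
private theorem card_eq_card_map_mul_card_ker {G G' : Type*} [AddCommGroup G] [AddCommGroup G'] (f : G →+ G')
    (H : AddSubgroup G) [Finite ↥H] :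
    Nat.card ↥H = Nat.card ↥(H.map f) * Nat.card ↥(f.comp H.subtype).ker := by
  have h1 := AddSubgroup.card_eq_card_quotient_mul_card_addSubgroup (f.comp H.subtype).ker
  rw [Nat.card_congr (QuotientAddGroup.quotientKerEquivRange (f.comp H.subtype)).toEquiv,
    AddMonoidHom.range_comp, AddSubgroup.range_subtype] at h1
  exact h1

end Count

namespace DVRSetting

variable {p : ℕ} [Fact p.Prime] {K : Type} [Field K] [NumberField K]
  {R : Type} [CommRing R] [IsDomain R] [IsDiscreteValuationRing R] [Algebra ℤ_[p] R]
  {N : ℕ → Type} [∀ k, AddCommGroup (N k)] [∀ k, TopologicalSpace (N k)]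
  [∀ k, DiscreteTopology (N k)] [∀ k, Module R (N k)]
  {Rk : ℕ → Type} [∀ k, CommRing (Rk k)] [∀ k, IsLocalRing (Rk k)] [∀ k, TopologicalSpace (Rk k)]
  [∀ k, DiscreteTopology (Rk k)] [∀ k, Algebra ℤ_[p] (Rk k)] [∀ k, Algebra R (Rk k)]
  [∀ k, Module (Rk k) (N k)] [∀ k, IsScalarTower R (Rk k) (N k)]
  {Nbar : Type} [AddCommGroup Nbar] [TopologicalSpace Nbar] [DiscreteTopology Nbar]
  [∀ k, Module (Rk k) Nbar]
  {Nq : ℕ → Finset (HeightOneSpectrum (𝓞 K)) → Type} [∀ k n, AddCommGroup (Nq k n)]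
  [∀ k n, TopologicalSpace (Nq k n)] [∀ k n, DiscreteTopology (Nq k n)]
  [∀ k n, Module (Rk k) (Nq k n)] [∀ k n, Module R (Nq k n)]
  [∀ k n, IsScalarTower R (Rk k) (Nq k n)]

/-- **The kernel of a reduction on a level Selmer group is the image of the complementary inclusion** (full tower,
Lemma 1.3.3 at level `n`): for `i ≤ t + 1 ≤ k`, `n ∈ 𝓝^{(k)}` and `x ∈ 𝓗_{t+1}(n) = H¹_{𝓕(n)}(K, T^{(t+1)})`,
`H¹(red_{t+1→i}) x = 0` iff `x = H¹(inc_{j→t+1}) a` for some `a ∈ 𝓗_j(n)`, where `e_j = e_{t+1} - e_i` (so `j = t - i` on a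
full tower: `T^{(j)} = 𝔪^{e_i} T^{(t+1)}`).  Stated for the two cases used below through the exponent identity `hj`.
[cite: Howard2004HeegnerKolyvagin, Lemma 1.3.3 (arXiv:1202.6340 p. 7 L152–160) and §1.6 ¶1 (p0011 L33–38)] -/
theorem redLEH1_eq_zero_iff_exists_incH1LE (S : DVRSetting p K R N Rk Nbar Nq) (hy : S.SatisfiesH)
    (hπm : S.π ∈ IsLocalRing.maximalIdeal R) (hle : ∀ k, S.e k ≤ S.e (k + 1))
    (k : ℕ) (n : Finset (HeightOneSpectrum (𝓞 K))) (hn : ↑n ⊆ S.levelPrimes k)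
    {i j t : ℕ} (hi : i ≤ t + 1) (hj' : j ≤ t + 1) (htk : t + 1 ≤ k) (hj : S.e j = S.e (t + 1) - S.e i)
    (x : galoisCohomology (S.T.ρ (t + 1)) 1) (hx : x ∈ (((S.t (t + 1)).atLevel S.jbar n).cond).selmerGroup) :
    S.redLEH1 hi x = 0 ↔ ∃ a ∈ (((S.t j).atLevel S.jbar n).cond).selmerGroup,
      AdicTower.incH1LE S.T S.π S.e hy.killed hy.ker_red hπm hle j (t + 1) hj' a = x := by
  have htriv := S.htriv_of_subset_levelPrimes hy hn
  have h133 := S.mem_selmerGroup_atLevel_and_pow_eq_zero_iff_exists_incH1LE hy hπm hle n k htriv hj' htk x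
  constructor
  · intro h0
    refine h133.1 ⟨hx, ?_⟩
    -- `π^{e_j} x = π^{e_{t+1} - e_i} x = H¹(inc_{i→t+1}) (H¹(red_{t+1→i}) x) = 0`
    rw [hj, ← S.incH1LE_redLEH1 hy hπm hle i (t + 1) hi x, h0, map_zero]
  · rintro ⟨a, ha, rfl⟩
    -- `H¹(inc_{i→t+1})` is injective and `H¹(inc_{i→t+1}) (H¹(red_{t+1→i}) (H¹(inc_{j→t+1}) a)) = π^{e_{t+1}-e_i} · inc a
    --  = inc (π^{e_{t+1}-e_i} a) = 0` since `π^{e_j} = π^{e_{t+1}-e_i}` kills `H¹(K, T^{(j)})`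
    apply S.incH1LE_injective hy hπm hle i (t + 1) hi
    rw [map_zero, S.incH1LE_redLEH1 hy hπm hle i (t + 1) hi]
    have hc := DFunLike.congr_fun
      (AdicTower.scalarMapH1_comp_incH1LE S.T S.π S.e hy.killed hy.ker_red hπm hle (S.π ^ (S.e (t + 1) - S.e i))
        j (t + 1) hj') a
    rw [AddMonoidHom.comp_apply, AddMonoidHom.comp_apply] at hc
    rw [hc]
    have hkill : galoisCohomology.scalarMapH1 (S.T.ρ j) (S.T.hlin j) (S.π ^ (S.e (t + 1) - S.e i)) a = 0 := by
      rw [← hj]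
      exact galoisCohomology.smul_eq_zero_of_forall (S.T.ρ j) (S.T.hlin j) _
        (fun y => hy.killed j _ (Ideal.pow_mem_pow hπm _) y) a
    rw [hkill, map_zero]

/-- **`#𝓗_{t+1}(n) = #𝓗_0(n) · #H¹(red_{t+1→t})(𝓗_{t+1}(n))`** on a FULL `DVRSetting` (`e_i = i + 1`) with H.0–H.5, for
`n ∈ 𝓝^{(k)}`, `t + 1 ≤ k`: the kernel of `H¹(red_{t+1→t})` on `𝓗_{t+1}(n)` is `H¹(inc^{t+1})(𝓗_0(n)) ≅ 𝓗_0(n)` (Lemma 1.3.3: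
«`H¹_𝓕(K, T[𝔪]) ≅ ℋ[𝔪]`»; `H¹(inc)` injective by H.5).
[cite: Howard2004HeegnerKolyvagin, Lemma 1.3.3 and the proof of Thm. 1.4.2 (arXiv:1202.6340 p. 7 L152–160, p0008 L116–L120)] -/
theorem card_selmerGroup_atLevel_succ_eq_card_zero_mul_card_map_redLEH1 (S : DVRSetting p K R N Rk Nbar Nq)
    (hy : S.SatisfiesH) (hfull : ∀ i, S.e i = i + 1) (k : ℕ) (n : Finset (HeightOneSpectrum (𝓞 K)))
    (hn : ↑n ⊆ S.levelPrimes k) (t : ℕ) (htk : t + 1 ≤ k) :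
    Nat.card ↥(((S.t (t + 1)).atLevel S.jbar n).cond).selmerGroup =
      Nat.card ↥(((S.t 0).atLevel S.jbar n).cond).selmerGroup *
        Nat.card ↥((((S.t (t + 1)).atLevel S.jbar n).cond).selmerGroup.map (S.redLEH1 (Nat.le_succ t))) := by
  classical
  have hπm : S.π ∈ IsLocalRing.maximalIdeal R := by rw [hy.unif]; exact Ideal.mem_span_singleton_self _
  have hle : ∀ j, S.e j ≤ S.e (j + 1) := fun j => hy.e_strictMono.monotone (Nat.le_succ j)
  haveI : Finite ↥(((S.t (t + 1)).atLevel S.jbar n).cond).selmerGroup := S.finite_selmerGroup_modify hy (t + 1) ∅ ∅ n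
  set H := (((S.t (t + 1)).atLevel S.jbar n).cond).selmerGroup with hH
  rw [card_eq_card_map_mul_card_ker (S.redLEH1 (Nat.le_succ t)) H, mul_comm]
  congr 1
  -- the kernel `{x ∈ 𝓗_{t+1}(n) | red x = 0}` is in bijection with `𝓗_0(n)` through `H¹(inc_{0→t+1})`
  have hj : S.e 0 = S.e (t + 1) - S.e t := by rw [hfull, hfull, hfull]; omega
  have htriv := S.htriv_of_subset_levelPrimes hy hn
  have key := fun (x : galoisCohomology (S.T.ρ (t + 1)) 1) (hx : x ∈ H) =>
    S.redLEH1_eq_zero_iff_exists_incH1LE hy hπm hle k n hn (Nat.le_succ t) (Nat.zero_le (t + 1)) htk hj x hx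
  have hmem : ∀ a : ↥(((S.t 0).atLevel S.jbar n).cond).selmerGroup,
      AdicTower.incH1LE S.T S.π S.e hy.killed hy.ker_red hπm hle 0 (t + 1) (Nat.zero_le (t + 1)) a.1 ∈ H := fun a =>
    ((S.mem_selmerGroup_atLevel_and_pow_eq_zero_iff_exists_incH1LE hy hπm hle n k htriv (Nat.zero_le (t + 1)) htk
      _).2 ⟨a.1, a.2, rfl⟩).1
  have hker : ∀ a : ↥(((S.t 0).atLevel S.jbar n).cond).selmerGroup,
      (⟨_, hmem a⟩ : ↥H) ∈ ((S.redLEH1 (Nat.le_succ t)).comp H.subtype).ker := fun a => by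
    rw [AddMonoidHom.mem_ker, AddMonoidHom.comp_apply]
    exact (key _ (hmem a)).2 ⟨a.1, a.2, rfl⟩
  symm
  refine Nat.card_congr (Equiv.ofBijective (fun a => (⟨⟨_, hmem a⟩, hker a⟩ :
    ↥((S.redLEH1 (Nat.le_succ t)).comp H.subtype).ker)) ⟨?_, ?_⟩)
  · -- injective: `H¹(inc_{0→t+1})` is
    intro a b hab
    have h1 := congrArg (fun z : ↥((S.redLEH1 (Nat.le_succ t)).comp H.subtype).ker =>
      ((z : ↥H) : galoisCohomology (S.T.ρ (t + 1)) 1)) hab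
    exact Subtype.ext (S.incH1LE_injective hy hπm hle 0 (t + 1) (Nat.zero_le (t + 1)) h1)
  · -- surjective: a class of `𝓗_{t+1}(n)` killed by `red` comes from `𝓗_0(n)`
    rintro ⟨⟨x, hx⟩, hx0⟩
    have hx0' : S.redLEH1 (Nat.le_succ t) x = 0 := by
      rw [AddMonoidHom.mem_ker, AddMonoidHom.comp_apply] at hx0
      exact hx0
    obtain ⟨a, ha, hax⟩ := (key x hx).1 hx0'
    exact ⟨⟨a, ha⟩, Subtype.ext (Subtype.ext hax)⟩

/-- **`#𝓗_{t+1}(n) = #𝓗_t(n) · #H¹(red_{t+1→0})(𝓗_{t+1}(n))`** on a FULL `DVRSetting` with H.0–H.5, for `n ∈ 𝓝^{(k)}`,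
`t + 1 ≤ k`: the kernel of `H¹(red_{t+1→0})` on `𝓗_{t+1}(n)` is `H¹(inc)(𝓗_t(n)) ≅ 𝓗_t(n)` (Lemma 1.3.3:
«`H¹_𝓕(K, T/𝔪^sT) ≅ ℋ[𝔪^s]`»).
[cite: Howard2004HeegnerKolyvagin, Lemma 1.3.3 and the proof of Thm. 1.4.2 (arXiv:1202.6340 p. 7 L152–160, p0008 L116–L120)] -/
theorem card_selmerGroup_atLevel_succ_eq_card_mul_card_map_redLEH1_zero (S : DVRSetting p K R N Rk Nbar Nq)
    (hy : S.SatisfiesH) (hfull : ∀ i, S.e i = i + 1) (k : ℕ) (n : Finset (HeightOneSpectrum (𝓞 K)))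
    (hn : ↑n ⊆ S.levelPrimes k) (t : ℕ) (htk : t + 1 ≤ k) :
    Nat.card ↥(((S.t (t + 1)).atLevel S.jbar n).cond).selmerGroup =
      Nat.card ↥(((S.t t).atLevel S.jbar n).cond).selmerGroup *
        Nat.card ↥((((S.t (t + 1)).atLevel S.jbar n).cond).selmerGroup.map (S.redLEH1 (Nat.zero_le (t + 1)))) := by
  classical
  have hπm : S.π ∈ IsLocalRing.maximalIdeal R := by rw [hy.unif]; exact Ideal.mem_span_singleton_self _
  have hle : ∀ j, S.e j ≤ S.e (j + 1) := fun j => hy.e_strictMono.monotone (Nat.le_succ j)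
  haveI : Finite ↥(((S.t (t + 1)).atLevel S.jbar n).cond).selmerGroup := S.finite_selmerGroup_modify hy (t + 1) ∅ ∅ n
  set H := (((S.t (t + 1)).atLevel S.jbar n).cond).selmerGroup with hH
  rw [card_eq_card_map_mul_card_ker (S.redLEH1 (Nat.zero_le (t + 1))) H, mul_comm]
  congr 1
  have hj : S.e t = S.e (t + 1) - S.e 0 := by rw [hfull, hfull, hfull]; omega
  have htriv := S.htriv_of_subset_levelPrimes hy hn
  have key := fun (x : galoisCohomology (S.T.ρ (t + 1)) 1) (hx : x ∈ H) =>
    S.redLEH1_eq_zero_iff_exists_incH1LE hy hπm hle k n hn (Nat.zero_le (t + 1)) (Nat.le_succ t) htk hj x hx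
  have hmem : ∀ a : ↥(((S.t t).atLevel S.jbar n).cond).selmerGroup,
      AdicTower.incH1LE S.T S.π S.e hy.killed hy.ker_red hπm hle t (t + 1) (Nat.le_succ t) a.1 ∈ H := fun a =>
    ((S.mem_selmerGroup_atLevel_and_pow_eq_zero_iff_exists_incH1LE hy hπm hle n k htriv (Nat.le_succ t) htk
      _).2 ⟨a.1, a.2, rfl⟩).1
  have hker : ∀ a : ↥(((S.t t).atLevel S.jbar n).cond).selmerGroup,
      (⟨_, hmem a⟩ : ↥H) ∈ ((S.redLEH1 (Nat.zero_le (t + 1))).comp H.subtype).ker := fun a => by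
    rw [AddMonoidHom.mem_ker, AddMonoidHom.comp_apply]
    exact (key _ (hmem a)).2 ⟨a.1, a.2, rfl⟩
  symm
  refine Nat.card_congr (Equiv.ofBijective (fun a => (⟨⟨_, hmem a⟩, hker a⟩ :
    ↥((S.redLEH1 (Nat.zero_le (t + 1))).comp H.subtype).ker)) ⟨?_, ?_⟩)
  · intro a b hab
    have h1 := congrArg (fun z : ↥((S.redLEH1 (Nat.zero_le (t + 1))).comp H.subtype).ker =>
      ((z : ↥H) : galoisCohomology (S.T.ρ (t + 1)) 1)) hab
    exact Subtype.ext (S.incH1LE_injective hy hπm hle t (t + 1) (Nat.le_succ t) h1)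
  · rintro ⟨⟨x, hx⟩, hx0⟩
    have hx0' : S.redLEH1 (Nat.zero_le (t + 1)) x = 0 := by
      rw [AddMonoidHom.mem_ker, AddMonoidHom.comp_apply] at hx0
      exact hx0
    obtain ⟨a, ha, hax⟩ := (key x hx).1 hx0'
    exact ⟨⟨a, ha⟩, Subtype.ext (Subtype.ext hax)⟩

/-! ## §2 The RIGHT kernel from the LEFT kernel -/

/-- **ONE KERNEL SUFFICES (Prop. 1.4.1 in tower currency).**  On a FULL `DVRSetting` (`e_i = i + 1`: `N_j = T/𝔪^{j+1}T`,
`N_0 = T̄`) with H.0–H.5, fix `k`, `n ∈ 𝓝^{(k)}`, `t + 1 < e_k`, and write `𝓗_j(n) = H¹_{𝓕(n)}(K, N_j)`.  Let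
`P₂ : 𝓗_t(n) × 𝓗_0(n) → R/𝔪` be bi-additive and `R`-equivariant in the second slot, with LEFT kernel EXACTLY
`H¹(red_{t+1→t})(𝓗_{t+1}(n))` («the kernel on the left is the image of `H¹_𝓕(K,T/𝔪^{s+1}T) → H¹_𝓕(K,T/𝔪^sT)`») and such that
`H¹(red_{t+1→0})(𝓗_{t+1}(n))` pairs to zero with everything.  THEN the RIGHT kernel is EXACTLY `H¹(red_{t+1→0})(𝓗_{t+1}(n))`
(«… and on the right the image of `π^s`», `T*`-side read on the `T`-side by H.4) — by the count
`#(𝓗_t/red 𝓗_{t+1}) = #(𝓗_0/red^{t+1} 𝓗_{t+1})` (§1) and §0 over the finite field `R/𝔪`.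
[cite: Howard2004HeegnerKolyvagin, Prop. 1.4.1 and the proof of Thm. 1.4.2 (arXiv:1202.6340 p0008 L83–L126), Lemma 1.3.3 (p. 7 L152–160)]
[cite: Flach1990, the generalised Cassels–Tate pairing and its kernels] -/
theorem towerPairing_hright_of_hleft (S : DVRSetting p K R N Rk Nbar Nq) (hy : S.SatisfiesH)
    (hfull : ∀ i, S.e i = i + 1) (k : ℕ) (n : Finset (HeightOneSpectrum (𝓞 K)))
    (hn : ↑n ⊆ S.levelPrimes k) (t : ℕ) (ht : t + 1 < S.e k)
    (P₂ : ↥(((S.t t).atLevel S.jbar n).cond).selmerGroup →+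
      ↥(((S.t 0).atLevel S.jbar n).cond).selmerGroup →+ (R ⧸ IsLocalRing.maximalIdeal R))
    (hP₂ : ∀ (r : R) (a : ↥(((S.t t).atLevel S.jbar n).cond).selmerGroup)
        (w w' : ↥(((S.t 0).atLevel S.jbar n).cond).selmerGroup),
      (w' : galoisCohomology (S.T.ρ 0) 1) =
        galoisCohomology.scalarMapH1 (S.T.ρ 0) (S.T.hlin 0) r (w : galoisCohomology (S.T.ρ 0) 1) →
      P₂ a w' = r • P₂ a w)
    (hleft : ∀ a : ↥(((S.t t).atLevel S.jbar n).cond).selmerGroup,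
      (∀ w, P₂ a w = 0) ↔ ∃ z ∈ (((S.t (t + 1)).atLevel S.jbar n).cond).selmerGroup,
        (a : galoisCohomology (S.T.ρ t) 1) = S.redLEH1 (Nat.le_succ t) z)
    (hright_le : ∀ z ∈ (((S.t (t + 1)).atLevel S.jbar n).cond).selmerGroup,
      ∀ w : ↥(((S.t 0).atLevel S.jbar n).cond).selmerGroup,
        (w : galoisCohomology (S.T.ρ 0) 1) = S.redLEH1 (Nat.zero_le (t + 1)) z → ∀ a, P₂ a w = 0) :
    ∀ w : ↥(((S.t 0).atLevel S.jbar n).cond).selmerGroup,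
      (∀ a, P₂ a w = 0) ↔ ∃ z ∈ (((S.t (t + 1)).atLevel S.jbar n).cond).selmerGroup,
        (w : galoisCohomology (S.T.ρ 0) 1) = S.redLEH1 (Nat.zero_le (t + 1)) z := by
  classical
  have htk : t + 1 ≤ k := by rw [hfull k] at ht; omega
  -- finiteness
  haveI hfinT : Finite ↥(((S.t t).atLevel S.jbar n).cond).selmerGroup := S.finite_selmerGroup_modify hy t ∅ ∅ n
  haveI hfin0 : Finite ↥(((S.t 0).atLevel S.jbar n).cond).selmerGroup := S.finite_selmerGroup_modify hy 0 ∅ ∅ n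
  haveI hfinS : Finite ↥(((S.t (t + 1)).atLevel S.jbar n).cond).selmerGroup :=
    S.finite_selmerGroup_modify hy (t + 1) ∅ ∅ n
  haveI : Finite (R ⧸ IsLocalRing.maximalIdeal R) := hy.coeffRing.finite_residueField
  letI : Field (R ⧸ IsLocalRing.maximalIdeal R) := Ideal.Quotient.field _
  -- `𝓗_0(n)` as an `R/𝔪`-vector space: `B := selmerModuleAt 0 n`, killed by `π` (`e_0 = 1`)
  letI modH : Module R (galoisCohomology (S.T.ρ 0) 1) := galoisCohomology.moduleH1 (S.T.ρ 0) (S.T.hlin 0)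
  have hsmul : ∀ (r : R) (x : galoisCohomology (S.T.ρ 0) 1),
      r • x = galoisCohomology.scalarMapH1 (S.T.ρ 0) (S.T.hlin 0) r x := fun _ _ => rfl
  have hLL : ∀ x : galoisCohomology (S.T.ρ 0) 1,
      x ∈ S.selmerModuleAt hy 0 n ↔ x ∈ (((S.t 0).atLevel S.jbar n).cond).selmerGroup := fun x => Iff.rfl
  haveI : Finite ↥(S.selmerModuleAt hy 0 n) := Finite.of_equiv _ (Equiv.subtypeEquivRight (fun x => (hLL x).symm))
  have hkill0 : ∀ x : galoisCohomology (S.T.ρ 0) 1, S.π • x = 0 := fun x => by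
    have h := S.pow_e_smul_eq_zero hy 0 x
    rwa [hfull 0, zero_add, pow_one] at h
  have htors : Module.IsTorsionBySet R ↥(S.selmerModuleAt hy 0 n) (IsLocalRing.maximalIdeal R) := by
    rintro x ⟨r, hr⟩
    have hr' : r ∈ Ideal.span {S.π} := by rw [← hy.unif]; exact hr
    obtain ⟨c, rfl⟩ := Ideal.mem_span_singleton'.1 hr'
    show (c * S.π) • x = 0
    apply Subtype.ext
    rw [Submodule.coe_smul, Submodule.coe_zero, mul_smul, hkill0, smul_zero]
  letI modB : Module (R ⧸ IsLocalRing.maximalIdeal R) ↥(S.selmerModuleAt hy 0 n) := htors.module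
  -- the identification of carriers `𝓗_0(n) = selmerModuleAt 0 n`
  let e : ↥(((S.t 0).atLevel S.jbar n).cond).selmerGroup ≃+ ↥(S.selmerModuleAt hy 0 n) :=
    { toFun := fun w => ⟨w.1, (hLL w.1).2 w.2⟩
      invFun := fun b => ⟨b.1, (hLL b.1).1 b.2⟩
      left_inv := fun w => rfl
      right_inv := fun b => rfl
      map_add' := fun w w' => rfl }
  -- `P₂ a` as an `R/𝔪`-linear form on `B`
  let P : ↥(((S.t t).atLevel S.jbar n).cond).selmerGroup →+
      (↥(S.selmerModuleAt hy 0 n) →ₗ[R ⧸ IsLocalRing.maximalIdeal R] (R ⧸ IsLocalRing.maximalIdeal R)) :=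
    { toFun := fun a =>
        { toFun := fun b => P₂ a (e.symm b)
          map_add' := fun b b' => by rw [map_add, map_add]
          map_smul' := fun c b => by
            obtain ⟨r, rfl⟩ := Ideal.Quotient.mk_surjective c
            have hmk : (Ideal.Quotient.mk (IsLocalRing.maximalIdeal R) r) • b = r • b :=
              Module.IsTorsionBySet.mk_smul htors r b
            rw [hmk, RingHom.id_apply]
            have h1 : ((e.symm (r • b) : ↥(((S.t 0).atLevel S.jbar n).cond).selmerGroup) :
                galoisCohomology (S.T.ρ 0) 1) =
              galoisCohomology.scalarMapH1 (S.T.ρ 0) (S.T.hlin 0) r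
                ((e.symm b : ↥(((S.t 0).atLevel S.jbar n).cond).selmerGroup) : galoisCohomology (S.T.ρ 0) 1) := by
              show ((r • b : ↥(S.selmerModuleAt hy 0 n)) : galoisCohomology (S.T.ρ 0) 1) = _
              rw [Submodule.coe_smul, hsmul]
              rfl
            rw [hP₂ r a (e.symm b) (e.symm (r • b)) h1, Algebra.smul_def, Ideal.Quotient.algebraMap_eq, smul_eq_mul] }
      map_zero' := by
        apply LinearMap.ext
        intro b
        show P₂ 0 (e.symm b) = 0
        rw [map_zero]
        rfl
      map_add' := fun a a' => by
        apply LinearMap.ext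
        intro b
        show P₂ (a + a') (e.symm b) = P₂ a (e.symm b) + P₂ a' (e.symm b)
        rw [map_add]
        rfl }
  have hP : ∀ a b, P a b = P₂ a (e.symm b) := fun _ _ => rfl
  -- the two subgroups: `A' = red(𝓗_{t+1})` inside `𝓗_t`, `B' = red^{t+1}(𝓗_{t+1})` inside `B`
  let A' : AddSubgroup ↥(((S.t t).atLevel S.jbar n).cond).selmerGroup :=
    ((((S.t (t + 1)).atLevel S.jbar n).cond).selmerGroup.map (S.redLEH1 (Nat.le_succ t))).addSubgroupOf
      (((S.t t).atLevel S.jbar n).cond).selmerGroup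
  let B'₀ : AddSubgroup ↥(((S.t 0).atLevel S.jbar n).cond).selmerGroup :=
    ((((S.t (t + 1)).atLevel S.jbar n).cond).selmerGroup.map (S.redLEH1 (Nat.zero_le (t + 1)))).addSubgroupOf
      (((S.t 0).atLevel S.jbar n).cond).selmerGroup
  let B' : AddSubgroup ↥(S.selmerModuleAt hy 0 n) := B'₀.map e.toAddMonoidHom
  have hmemA' : ∀ a : ↥(((S.t t).atLevel S.jbar n).cond).selmerGroup, a ∈ A' ↔
      ∃ z ∈ (((S.t (t + 1)).atLevel S.jbar n).cond).selmerGroup,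
        (a : galoisCohomology (S.T.ρ t) 1) = S.redLEH1 (Nat.le_succ t) z := by
    intro a
    rw [AddSubgroup.mem_addSubgroupOf, AddSubgroup.mem_map]
    constructor
    · rintro ⟨z, hz, hza⟩; exact ⟨z, hz, hza.symm⟩
    · rintro ⟨z, hz, hza⟩; exact ⟨z, hz, hza.symm⟩
  have hmemB'₀ : ∀ w : ↥(((S.t 0).atLevel S.jbar n).cond).selmerGroup, w ∈ B'₀ ↔
      ∃ z ∈ (((S.t (t + 1)).atLevel S.jbar n).cond).selmerGroup,
        (w : galoisCohomology (S.T.ρ 0) 1) = S.redLEH1 (Nat.zero_le (t + 1)) z := by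
    intro w
    rw [AddSubgroup.mem_addSubgroupOf, AddSubgroup.mem_map]
    constructor
    · rintro ⟨z, hz, hzw⟩; exact ⟨z, hz, hzw.symm⟩
    · rintro ⟨z, hz, hzw⟩; exact ⟨z, hz, hzw.symm⟩
  have hmemB' : ∀ b : ↥(S.selmerModuleAt hy 0 n), b ∈ B' ↔ e.symm b ∈ B'₀ := by
    intro b
    rw [AddSubgroup.mem_map]
    constructor
    · rintro ⟨w, hw, rfl⟩
      exact (congrArg (· ∈ B'₀) (e.symm_apply_apply w)).mpr hw
    · intro h
      exact ⟨e.symm b, h, e.apply_symm_apply b⟩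
  -- cardinalities: the maps `red(𝓗_{t+1}) ≤ 𝓗_t`, `red^{t+1}(𝓗_{t+1}) ≤ 𝓗_0`
  have hA'le : (((S.t (t + 1)).atLevel S.jbar n).cond).selmerGroup.map (S.redLEH1 (Nat.le_succ t)) ≤
      (((S.t t).atLevel S.jbar n).cond).selmerGroup := by
    rintro _ ⟨z, hz, rfl⟩
    exact S.redLEH1_mem_selmerGroup_atLevel hy (Nat.le_succ t) n hz
  have hB'le : (((S.t (t + 1)).atLevel S.jbar n).cond).selmerGroup.map (S.redLEH1 (Nat.zero_le (t + 1))) ≤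
      (((S.t 0).atLevel S.jbar n).cond).selmerGroup := by
    rintro _ ⟨z, hz, rfl⟩
    exact S.redLEH1_mem_selmerGroup_atLevel hy (Nat.zero_le (t + 1)) n hz
  have hcardA' : Nat.card ↥A' =
      Nat.card ↥((((S.t (t + 1)).atLevel S.jbar n).cond).selmerGroup.map (S.redLEH1 (Nat.le_succ t))) :=
    Nat.card_congr (AddSubgroup.addSubgroupOfEquivOfLe hA'le).toEquiv
  have hcardB'₀ : Nat.card ↥B'₀ =
      Nat.card ↥((((S.t (t + 1)).atLevel S.jbar n).cond).selmerGroup.map (S.redLEH1 (Nat.zero_le (t + 1)))) :=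
    Nat.card_congr (AddSubgroup.addSubgroupOfEquivOfLe hB'le).toEquiv
  have hcardB' : Nat.card ↥B' = Nat.card ↥B'₀ :=
    (Nat.card_congr (B'₀.equivMapOfInjective e.toAddMonoidHom e.injective).toEquiv).symm
  have hcardB : Nat.card ↥(S.selmerModuleAt hy 0 n) = Nat.card ↥(((S.t 0).atLevel S.jbar n).cond).selmerGroup :=
    Nat.card_congr e.symm.toEquiv
  have hcount : Nat.card ↥(((S.t t).atLevel S.jbar n).cond).selmerGroup * Nat.card ↥B' =
      Nat.card ↥A' * Nat.card ↥(S.selmerModuleAt hy 0 n) := by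
    rw [hcardB', hcardB'₀, hcardA', hcardB,
      ← S.card_selmerGroup_atLevel_succ_eq_card_mul_card_map_redLEH1_zero hy hfull k n hn t htk,
      mul_comm, ← S.card_selmerGroup_atLevel_succ_eq_card_zero_mul_card_map_redLEH1 hy hfull k n hn t htk]
  -- §0
  have hleftP : ∀ a, (∀ b, P a b = 0) ↔ a ∈ A' := by
    intro a
    rw [hmemA' a, ← hleft a]
    constructor
    · intro h w
      have h2 := h (e w)
      rw [hP] at h2
      exact h2
    · intro h b
      rw [hP]
      exact h _
  have hB'P : ∀ b ∈ B', ∀ a, P a b = 0 := by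
    intro b hb a
    rw [hP]
    obtain ⟨z, hz, hzw⟩ := (hmemB'₀ _).1 ((hmemB' b).1 hb)
    exact hright_le z hz _ hzw a
  have main := forall_apply_eq_zero_iff_mem_of_leftKer_of_card P A' B' hleftP hB'P hcount
  -- read back on `𝓗_0(n)`
  intro w
  have h1 : (∀ a, P₂ a w = 0) ↔ ∀ a, P a (e w) = 0 := by
    refine forall_congr' fun a => ?_
    rw [hP]
    rfl
  rw [h1, main (e w), hmemB', ← hmemB'₀ w]
  rfl

/-! ## §3 `HasLevelDecompositionsAt` and the leaf C45.1′ from LEFT-kernel pairings on full towers -/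

/-- **THM. 1.4.2-AS-APPLIED ON ONE FULL SETTING FROM LEFT-KERNEL TOWER PAIRINGS.**  On a FULL `DVRSetting` with H.0–H.5,
two-module pairings `H¹_{𝓕(n)}(K, T^{(t)}) × H¹_{𝓕(n)}(K, T^{(0)}) → R/𝔪` at every `(k, n ∈ 𝓝^{(k)}, t + 1 < e_k)`, `R`-equivariant
in both slots, with LEFT kernel `H¹(red)(H¹_{𝓕(n)}(K, T^{(t+1)}))` (Prop. 1.4.1), with `H¹(red^{t+1})(H¹_{𝓕(n)}(K, T^{(t+1)}))`
pairing to zero, and with display (ii) `P₂(a, H¹(red^t) b) = -P₂(b, H¹(red^t) a)`, give `S.HasLevelDecompositionsAt hy` — §2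
supplies the RIGHT kernel, then x10b-p1-w7 g12's `hasLevelDecompositionsAt_of_towerSkewPairings`.
[cite: Howard2004HeegnerKolyvagin, Prop. 1.4.1, Thm. 1.4.2 (with proof) and §1.6 ¶1 (arXiv:1202.6340 p0008 L83–L142, p0011 L33–44)]
[cite: Flach1990, the generalised Cassels–Tate pairing and its kernels] -/
theorem hasLevelDecompositionsAt_of_towerLeftKernelPairings (S : DVRSetting p K R N Rk Nbar Nq) (hy : S.SatisfiesH)
    (hfull : ∀ i, S.e i = i + 1)
    (h : ∀ (k : ℕ) (n : Finset (HeightOneSpectrum (𝓞 K))), ↑n ⊆ S.levelPrimes k → ∀ (t : ℕ), t + 1 < S.e k →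
      ∃ P₂ : ↥(((S.t t).atLevel S.jbar n).cond).selmerGroup →+
          ↥(((S.t 0).atLevel S.jbar n).cond).selmerGroup →+ (R ⧸ IsLocalRing.maximalIdeal R),
        (∀ (r : R) (a a' : ↥(((S.t t).atLevel S.jbar n).cond).selmerGroup)
            (w : ↥(((S.t 0).atLevel S.jbar n).cond).selmerGroup),
          (a' : galoisCohomology (S.T.ρ t) 1) =
            galoisCohomology.scalarMapH1 (S.T.ρ t) (S.T.hlin t) r (a : galoisCohomology (S.T.ρ t) 1) →
          P₂ a' w = r • P₂ a w) ∧
        (∀ (r : R) (a : ↥(((S.t t).atLevel S.jbar n).cond).selmerGroup)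
            (w w' : ↥(((S.t 0).atLevel S.jbar n).cond).selmerGroup),
          (w' : galoisCohomology (S.T.ρ 0) 1) =
            galoisCohomology.scalarMapH1 (S.T.ρ 0) (S.T.hlin 0) r (w : galoisCohomology (S.T.ρ 0) 1) →
          P₂ a w' = r • P₂ a w) ∧
        (∀ a : ↥(((S.t t).atLevel S.jbar n).cond).selmerGroup,
          (∀ w, P₂ a w = 0) ↔ ∃ z ∈ (((S.t (t + 1)).atLevel S.jbar n).cond).selmerGroup,
            (a : galoisCohomology (S.T.ρ t) 1) = S.redLEH1 (Nat.le_succ t) z) ∧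
        (∀ z ∈ (((S.t (t + 1)).atLevel S.jbar n).cond).selmerGroup,
          ∀ w : ↥(((S.t 0).atLevel S.jbar n).cond).selmerGroup,
            (w : galoisCohomology (S.T.ρ 0) 1) = S.redLEH1 (Nat.zero_le (t + 1)) z → ∀ a, P₂ a w = 0) ∧
        (∀ (a b : ↥(((S.t t).atLevel S.jbar n).cond).selmerGroup)
            (a₀ b₀ : ↥(((S.t 0).atLevel S.jbar n).cond).selmerGroup),
          (a₀ : galoisCohomology (S.T.ρ 0) 1) = S.redLEH1 (Nat.zero_le t) (a : galoisCohomology (S.T.ρ t) 1) →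
          (b₀ : galoisCohomology (S.T.ρ 0) 1) = S.redLEH1 (Nat.zero_le t) (b : galoisCohomology (S.T.ρ t) 1) →
          P₂ a b₀ = - P₂ b a₀)) :
    S.HasLevelDecompositionsAt hy := by
  refine S.hasLevelDecompositionsAt_of_towerSkewPairings hy hfull fun k n hn t ht => ?_
  obtain ⟨P₂, h₁, h₂, h₃, h₄, h₅⟩ := h k n hn t ht
  exact ⟨P₂, h₁, h₂, h₃, S.towerPairing_hright_of_hleft hy hfull k n hn t ht P₂ h₂ h₃ h₄, h₅⟩

end DVRSetting

/-- **THE FLACH LEAF FROM LEFT-KERNEL TOWER PAIRINGS.**  If on every FULL `DVRSetting` with H.0–H.5, for every `k`,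
`n ∈ 𝓝^{(k)}`, `t + 1 < e_k`, there is a bi-additive `R`-equivariant pairing `P₂ : H¹_{𝓕(n)}(K, T^{(t)}) × H¹_{𝓕(n)}(K, T^{(0)}) → R/𝔪`
with LEFT kernel `H¹(red)(H¹_{𝓕(n)}(K, T^{(t+1)}))`, with `H¹(red^{t+1})(H¹_{𝓕(n)}(K, T^{(t+1)}))` pairing to zero and with
`P₂(a, H¹(red^t) b) = -P₂(b, H¹(red^t) a)`, then the typed print leaf `prop141_casselsTate_skewPairing_atLevel` holds — §3 on
each full setting, then `prop141_casselsTate_skewPairing_atLevel_of_forall_full_hasLevelDecompositionsAt` (x10b-p1-w7 g11).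
The RIGHT-kernel computation of Prop. 1.4.1 is thus NOT on the path from a kernel port to the leaf.  Nothing of the pairing is
constructed here.
[cite: Howard2004HeegnerKolyvagin, Prop. 1.4.1, Thm. 1.4.2 (with proof) and §1.6 ¶1 with Rem. 1.3.1 (arXiv:1202.6340 p0008 L83–L142, p0011 L33–44, p0007 L125–127)]
[cite: Flach1990, the generalised Cassels–Tate pairing and its kernels] -/
theorem prop141_casselsTate_skewPairing_atLevel_of_forall_full_towerLeftKernelPairings
    (h : ∀ (p : ℕ) [Fact p.Prime] (K : Type) [Field K] [NumberField K]
      (R : Type) [CommRing R] [IsDomain R] [IsDiscreteValuationRing R] [Algebra ℤ_[p] R]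
      (N : ℕ → Type) [∀ k, AddCommGroup (N k)] [∀ k, TopologicalSpace (N k)]
      [∀ k, DiscreteTopology (N k)] [∀ k, Module R (N k)]
      (Rk : ℕ → Type) [∀ k, CommRing (Rk k)] [∀ k, IsLocalRing (Rk k)] [∀ k, TopologicalSpace (Rk k)]
      [∀ k, DiscreteTopology (Rk k)] [∀ k, Algebra ℤ_[p] (Rk k)] [∀ k, Algebra R (Rk k)]
      [∀ k, Module (Rk k) (N k)] [∀ k, IsScalarTower R (Rk k) (N k)]
      (Nbar : Type) [AddCommGroup Nbar] [TopologicalSpace Nbar] [DiscreteTopology Nbar]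
      [∀ k, Module (Rk k) Nbar]
      (Nq : ℕ → Finset (HeightOneSpectrum (𝓞 K)) → Type) [∀ k n, AddCommGroup (Nq k n)]
      [∀ k n, TopologicalSpace (Nq k n)] [∀ k n, DiscreteTopology (Nq k n)]
      [∀ k n, Module (Rk k) (Nq k n)] [∀ k n, Module R (Nq k n)]
      [∀ k n, IsScalarTower R (Rk k) (Nq k n)]
      (S : DVRSetting p K R N Rk Nbar Nq) (hy : S.SatisfiesH), (∀ i, S.e i = i + 1) →
      ∀ (k : ℕ) (n : Finset (HeightOneSpectrum (𝓞 K))), ↑n ⊆ S.levelPrimes k → ∀ (t : ℕ), t + 1 < S.e k →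
      ∃ P₂ : ↥(((S.t t).atLevel S.jbar n).cond).selmerGroup →+
          ↥(((S.t 0).atLevel S.jbar n).cond).selmerGroup →+ (R ⧸ IsLocalRing.maximalIdeal R),
        (∀ (r : R) (a a' : ↥(((S.t t).atLevel S.jbar n).cond).selmerGroup)
            (w : ↥(((S.t 0).atLevel S.jbar n).cond).selmerGroup),
          (a' : galoisCohomology (S.T.ρ t) 1) =
            galoisCohomology.scalarMapH1 (S.T.ρ t) (S.T.hlin t) r (a : galoisCohomology (S.T.ρ t) 1) →
          P₂ a' w = r • P₂ a w) ∧
        (∀ (r : R) (a : ↥(((S.t t).atLevel S.jbar n).cond).selmerGroup)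
            (w w' : ↥(((S.t 0).atLevel S.jbar n).cond).selmerGroup),
          (w' : galoisCohomology (S.T.ρ 0) 1) =
            galoisCohomology.scalarMapH1 (S.T.ρ 0) (S.T.hlin 0) r (w : galoisCohomology (S.T.ρ 0) 1) →
          P₂ a w' = r • P₂ a w) ∧
        (∀ a : ↥(((S.t t).atLevel S.jbar n).cond).selmerGroup,
          (∀ w, P₂ a w = 0) ↔ ∃ z ∈ (((S.t (t + 1)).atLevel S.jbar n).cond).selmerGroup,
            (a : galoisCohomology (S.T.ρ t) 1) = S.redLEH1 (Nat.le_succ t) z) ∧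
        (∀ z ∈ (((S.t (t + 1)).atLevel S.jbar n).cond).selmerGroup,
          ∀ w : ↥(((S.t 0).atLevel S.jbar n).cond).selmerGroup,
            (w : galoisCohomology (S.T.ρ 0) 1) = S.redLEH1 (Nat.zero_le (t + 1)) z → ∀ a, P₂ a w = 0) ∧
        (∀ (a b : ↥(((S.t t).atLevel S.jbar n).cond).selmerGroup)
            (a₀ b₀ : ↥(((S.t 0).atLevel S.jbar n).cond).selmerGroup),
          (a₀ : galoisCohomology (S.T.ρ 0) 1) = S.redLEH1 (Nat.zero_le t) (a : galoisCohomology (S.T.ρ t) 1) →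
          (b₀ : galoisCohomology (S.T.ρ 0) 1) = S.redLEH1 (Nat.zero_le t) (b : galoisCohomology (S.T.ρ t) 1) →
          P₂ a b₀ = - P₂ b a₀)) :
    prop141_casselsTate_skewPairing_atLevel := by
  refine prop141_casselsTate_skewPairing_atLevel_of_forall_full_hasLevelDecompositionsAt ?_
  intro p _ K _ _ R _ _ _ _ N _ _ _ _ Rk _ _ _ _ _ _ _ _ Nbar _ _ _ _ Nq _ _ _ _ _ _ S hy hfull
  exact S.hasLevelDecompositionsAt_of_towerLeftKernelPairings hy hfull (h p K R N Rk Nbar Nq S hy hfull)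

end Literature.NumberTheory.GaloisCohomology.Howard2004

end
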